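import Summits.KontsevichZagierPeriods.KontsevichZagierPeriods.Theorems.KzOnePeriodsE1DerivEggLogs

/-!
# KontsevichZagierPeriods — kz1p class E1 derivations, part 5: egg logarithms for real (irrational) 2-torsion

Cell pub-kz1p (KZ 1-periods), seat b2b-kz1p-2 (IMPLEMENTER), gen 13; helper of the rung-1 item
`stmt-KontsevichZagierPeriods-4990`, companion of parts 2 (`KzOnePeriodsE1DerivRealLogs`) and 4
(`KzOnePeriodsE1DerivEggLogs`).  Pure mathematics over the tree's real-lattice theory; no named facts,
no `sorry`, no new definitions.

Part 4 gives a rational point `P` on the egg component the logarithm `w_I + s`, `s` the principal real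
logarithm of `P ⊕ (e₃, 0)`, but leaves the computation of `P ⊕ (e₃, 0)` to the case files — which works
when the three 2-torsion abscissae `e₃ < e₂ < e₁` are rational.  This file does the translation ONCE,
abstractly, so that `e₁, e₂, e₃` may be arbitrary reals (kz1p corpus case E1-27, `x³ − 3x + 1`):

* `exists_eggLog_of_roots_pos` / `_neg`: if `4x³ − g₂x − g₃ = 4(x − r₁)(x − r₂)(x − r₃)`, `r₃ < r₂ < r₁`,
  and `(x, y)` is a real point of the curve with `r₃ < x < r₂` (the egg, 2-torsion excluded), then there is
  a real `s` with `φ(w_I + s) = (x, y)`, `s ∈ (0, Ω₁/2)` if `y > 0` and `s ∈ (−Ω₁/2, 0)` if `y < 0`.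
  Proof: `(x, y) = φ(u₀)` for some `u₀` (`℘` is onto, Mathlib/tree `PeriodPair.exists_weierstrassP_eq`);
  `φ(u₀ + w_I) = (x', y')` by the chord law (part 4 `phi_add_of_ne`) with
  `x' − r₁ = (x − r₂)(r₃ − r₁)/(x − r₃) > 0` (Vieta `r₁ + r₂ + r₃ = 0`) and `sign y' = −sign y`, so
  `(x', y')` lies on the identity component and has a principal real logarithm `s` (part 2); then
  `s ≡ u₀ + w_I (mod Λ)` (`PeriodPair.sub_mem_lattice_of_weierstrassP_eq`) and `φ(w_I + s) = φ(u₀ + 2w_I)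
  = φ(u₀)`.
* `cubic_factor_of_roots`, `exists_cubic_root_of_neg_pos` / `_of_pos_neg`: the three real roots from
  rational sign changes (intermediate value theorem) and the factorisation they force — the case files'
  `roots_exist` certificate for irrational 2-torsion;
* `exists_phi_eq`: every point of the curve is a `φ(u)`, `u ∉ Λ`.

References: [HuberWustholz2022] §13.1 (pp. 119–121), §18.1 (pp. 160–161); [Lawden1989] D. F. Lawden,
*Elliptic Functions and Applications* (1989), §§6.7, 6.11, 6.15; [SilvermanAEC2009] III.2.3 (group law),
VI.3.6(b) (`℘` onto); [CremonaAlgorithms1997] §3.4 (egg points: shift by `ω₂/2`).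
-/

noncomputable section

open Set Complex
open Literature.NumberTheory.Transcendental Literature.NumberTheory.Transcendental.CurvePeriods
open Literature.NumberTheory.Transcendental.CurvePeriods.Ell
open scoped PeriodPair ComplexConjugate

namespace Summit.KontsevichZagierPeriods.KzOnePeriods.E1RealLogs

variable {L : PeriodPair}

/-- `w_I = iΩ₁'/2`, `Ω₁'` the least positive real period of the real lattice `iΛ` (local notation). -/
local notation3 (prettyPrint := false) "wI" =>
  (I * ((((PeriodPair.mulLeft I I_ne_zero L).minRealPeriod / 2 : ℝ)) : ℂ))

/-! ### Real roots of the Weierstrass cubic -/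

/-- **Three distinct real roots factor the cubic**: if `r₃ < r₂ < r₁` are roots of `4x³ − px − q` then
`4x³ − px − q = 4(x − r₁)(x − r₂)(x − r₃)` (and `r₁ + r₂ + r₃ = 0`). [folklore] -/
theorem cubic_factor_of_roots {p q r₁ r₂ r₃ : ℝ} (h₁ : 4 * r₁ ^ 3 - p * r₁ - q = 0)
    (h₂ : 4 * r₂ ^ 3 - p * r₂ - q = 0) (h₃ : 4 * r₃ ^ 3 - p * r₃ - q = 0) (h12 : r₂ < r₁)
    (h23 : r₃ < r₂) : ∀ x, 4 * x ^ 3 - p * x - q = 4 * (x - r₁) * (x - r₂) * (x - r₃) := by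
  have e12 : 4 * (r₁ ^ 2 + r₁ * r₂ + r₂ ^ 2) = p := by
    have e : (r₁ - r₂) * (4 * (r₁ ^ 2 + r₁ * r₂ + r₂ ^ 2) - p) = 0 := by linear_combination h₁ - h₂
    rcases mul_eq_zero.1 e with e | e
    · exact absurd (sub_eq_zero.1 e) h12.ne'
    · exact sub_eq_zero.1 e
  have e13 : 4 * (r₁ ^ 2 + r₁ * r₃ + r₃ ^ 2) = p := by
    have e : (r₁ - r₃) * (4 * (r₁ ^ 2 + r₁ * r₃ + r₃ ^ 2) - p) = 0 := by linear_combination h₁ - h₃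
    rcases mul_eq_zero.1 e with e | e
    · exact absurd (sub_eq_zero.1 e) (h23.trans h12).ne'
    · exact sub_eq_zero.1 e
  have hs : r₃ = -r₁ - r₂ := by
    have e : (r₂ - r₃) * (4 * (r₁ + r₂ + r₃)) = 0 := by linear_combination e12 - e13
    rcases mul_eq_zero.1 e with e | e
    · exact absurd (sub_eq_zero.1 e) h23.ne'
    · linarith
  have hq : q = 4 * r₁ ^ 3 - p * r₁ := by linarith
  intro x
  rw [hs, hq, ← e12]
  ring

/-- A root of `4x³ − px − q` in `(a, b)` from a sign change `f(a) < 0 < f(b)` (intermediate value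
theorem). [folklore] -/
theorem exists_cubic_root_of_neg_pos {p q a b : ℝ} (hab : a < b) (ha : 4 * a ^ 3 - p * a - q < 0)
    (hb : 0 < 4 * b ^ 3 - p * b - q) : ∃ r, a < r ∧ r < b ∧ 4 * r ^ 3 - p * r - q = 0 := by
  have hcont : ContinuousOn (fun x : ℝ => 4 * x ^ 3 - p * x - q) (Icc a b) := by fun_prop
  obtain ⟨r, hr, hr0⟩ := intermediate_value_Ioo hab.le hcont ⟨ha, hb⟩
  exact ⟨r, hr.1, hr.2, hr0⟩

/-- A root of `4x³ − px − q` in `(a, b)` from a sign change `f(a) > 0 > f(b)`. [folklore] -/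
theorem exists_cubic_root_of_pos_neg {p q a b : ℝ} (hab : a < b) (ha : 0 < 4 * a ^ 3 - p * a - q)
    (hb : 4 * b ^ 3 - p * b - q < 0) : ∃ r, a < r ∧ r < b ∧ 4 * r ^ 3 - p * r - q = 0 := by
  have hcont : ContinuousOn (fun x : ℝ => 4 * x ^ 3 - p * x - q) (Icc a b) := by fun_prop
  obtain ⟨r, hr, hr0⟩ := intermediate_value_Ioo' hab.le hcont ⟨hb, ha⟩
  exact ⟨r, hr.1, hr.2, hr0⟩

/-! ### Every point of the curve is a `φ(u)` -/

/-- **`φ` is onto the affine curve**: if `4x³ − g₂x − g₃ = 4y²` then `(x, y) = φ(u)` for some `u ∉ Λ`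
(`℘` takes the value `x`, and `℘′(u)² = 4y²` fixes the sign up to `u ↦ −u`).
[cite: SilvermanAEC2009, Prop. VI.3.6(b)] -/
theorem exists_phi_eq {x y : ℂ} (h : 4 * x ^ 3 - L.g₂ * x - L.g₃ = 4 * y ^ 2) :
    ∃ u ∉ L.lattice, phi L u = ![x, y] := by
  obtain ⟨z, hz, hzx⟩ := L.exists_weierstrassP_eq x
  have hsq := L.derivWeierstrassP_sq z hz
  rw [hzx, h] at hsq
  have e : (℘'[L] z - 2 * y) * (℘'[L] z + 2 * y) = 0 := by linear_combination hsq
  rcases mul_eq_zero.1 e with e | e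
  · refine ⟨z, hz, ?_⟩
    funext k; fin_cases k
    · simp [hzx]
    · show ℘'[L] z / 2 = y
      linear_combination e / 2
  · refine ⟨-z, neg_notMem hz, ?_⟩
    rw [phi_neg]
    funext k; fin_cases k
    · simp [hzx]
    · show -(℘'[L] z / 2) = y
      linear_combination -e / 2

/-! ### Egg logarithms for arbitrary real 2-torsion -/

/-- **Principal logarithm of an egg point, `y > 0`**: three real roots `r₃ < r₂ < r₁`, a real point
`(x, y)` of the curve with `r₃ < x < r₂` and `y > 0`; then `φ(w_I + s) = (x, y)` for some
`s ∈ (0, Ω₁/2)` — namely `s` = the principal real logarithm of `(x, y) ⊕ (r₃, 0)`, which lies on the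
identity component (`x' − r₁ = (x − r₂)(r₃ − r₁)/(x − r₃) > 0`) with `y' < 0`.
[cite: Lawden1989, §§6.11, 6.15; CremonaAlgorithms1997, §3.4] -/
theorem exists_eggLog_of_roots_pos (h : L.IsReal) {r₁ r₂ r₃ : ℝ} (h12 : r₂ < r₁) (h23 : r₃ < r₂)
    (hf : ∀ x, 4 * x ^ 3 - L.g₂.re * x - L.g₃.re = 4 * (x - r₁) * (x - r₂) * (x - r₃)) {x y : ℝ}
    (hc : 4 * x ^ 3 - L.g₂.re * x - L.g₃.re = 4 * y ^ 2) (h3 : r₃ < x) (h2 : x < r₂) (hy : 0 < y) :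
    ∃ s : ℝ, 0 < s ∧ s < L.minRealPeriod / 2 ∧ phi L (wI + (s : ℂ)) = ![(x : ℂ), (y : ℂ)] := by
  obtain ⟨h2w, hwn, -⟩ := h.two_mul_halfPeriodI_mem
  have he : L.weierstrassPRe (L.minRealPeriod / 2) = r₁ := weierstrassPRe_half_eq_of_roots h h12 h23 hf
  have hT3 : phi L wI = ![(r₃ : ℂ), 0] := phi_halfPeriodI_of_roots h h12 h23 hf
  -- Vieta: the `x²`-coefficient
  have hs : r₁ + r₂ + r₃ = 0 := by
    have h0 := hf 0
    have h1 := hf 1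
    have h1' := hf (-1)
    linear_combination (h1 + h1' - 2 * h0) / 8
  -- a preimage `u₀` of `(x, y)`
  have hcC : 4 * (x : ℂ) ^ 3 - L.g₂ * x - L.g₃ = 4 * (y : ℂ) ^ 2 := by
    rw [← h.ofReal_g₂_re, ← h.ofReal_g₃_re]; exact_mod_cast hc
  obtain ⟨u₀, hu₀Λ, hu₀⟩ := exists_phi_eq hcC
  -- `X' := (x, y) ⊕ (r₃, 0) = φ(u₀ + w_I)`
  have hxr3 : 0 < x - r₃ := by linarith
  have hx3 : (x : ℂ) ≠ (r₃ : ℂ) := by exact_mod_cast (ne_of_gt h3)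
  set x' : ℝ := (y / (x - r₃)) ^ 2 - x - r₃ with hx'
  set y' : ℝ := y / (x - r₃) * (x - x') - y with hy'
  have hX' : phi L (u₀ + wI) = ![(x' : ℂ), (y' : ℂ)] :=
    phi_add_of_ne hu₀Λ hwn hu₀ hT3 hx3 (by rw [hx']; push_cast; ring) (by rw [hy', hx']; push_cast; ring)
  have hX'Λ : u₀ + wI ∉ L.lattice := add_notMem_of_phi_ne hu₀ hT3 hx3
  -- `X'` is on the curve (the differential equation at `u₀ + w_I`)
  have hc' : 4 * x' ^ 3 - L.g₂.re * x' - L.g₃.re = 4 * y' ^ 2 := by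
    obtain ⟨e1, e2⟩ := wp_eq_of_phi hX'
    have e := L.derivWeierstrassP_sq (u₀ + wI) hX'Λ
    rw [e1, e2, ← h.ofReal_g₂_re, ← h.ofReal_g₃_re] at e
    have e' : ((4 * x' ^ 3 - L.g₂.re * x' - L.g₃.re : ℝ) : ℂ) = ((4 * y' ^ 2 : ℝ) : ℂ) := by
      push_cast; linear_combination -e
    exact_mod_cast e'
  -- `X'` lies on the identity component: `x' > r₁ = e₁`
  have hprod : y ^ 2 = (x - r₁) * (x - r₂) * (x - r₃) := by linarith [hf x]
  have hx'' : x' = (x - r₁) * (x - r₂) / (x - r₃) - x - r₃ := by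
    rw [hx', div_pow, hprod]; field_simp
  have hx'r₁ : r₁ < x' := by
    have e1 : x' * (x - r₃) = (x - r₁) * (x - r₂) - (x + r₃) * (x - r₃) := by
      rw [hx'', sub_mul, sub_mul, div_mul_cancel₀ _ hxr3.ne']; ring
    have key : (x' - r₁) * (x - r₃) = (x - r₂) * (r₃ - r₁) := by
      linear_combination e1 + (r₃ - x) * hs
    have hpos : 0 < (x' - r₁) * (x - r₃) := by
      rw [key]; exact mul_pos_of_neg_of_neg (by linarith) (by linarith)
    by_contra hle
    push Not at hle
    have : (x' - r₁) * (x - r₃) ≤ 0 := mul_nonpos_of_nonpos_of_nonneg (by linarith) hxr3.le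
    linarith
  -- and in the lower half plane: `y' < 0`
  have hy'neg : y' < 0 := by
    have h1 : 0 < y / (x - r₃) := div_pos hy hxr3
    have h2 : x - x' < 0 := by linarith
    have := mul_neg_of_pos_of_neg h1 h2
    rw [hy']; linarith
  -- its principal real logarithm `s`
  obtain ⟨s, hs0, hsΩ, hsφ⟩ := exists_log_of_neg h (by rw [he]; exact hx'r₁) hc' hy'neg
  have hsΛ : (s : ℂ) ∉ L.lattice := notMem_of_pos h hs0 hsΩ.le
  -- `s ≡ u₀ + w_I (mod Λ)`, hence `φ(w_I + s) = φ(u₀ + 2w_I) = φ(u₀)`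
  obtain ⟨es1, es2⟩ := wp_eq_of_phi hsφ
  obtain ⟨eX1, eX2⟩ := wp_eq_of_phi hX'
  have hm : (s : ℂ) - (u₀ + wI) ∈ L.lattice :=
    L.sub_mem_lattice_of_weierstrassP_eq hsΛ hX'Λ (by rw [es1, eX1]) (by rw [es2, eX2])
  refine ⟨s, hs0, hsΩ, ?_⟩
  have e : wI + (s : ℂ) = u₀ + ((s : ℂ) - (u₀ + wI) + 2 * wI) := by ring
  rw [e, phi_add_of_mem L u₀ (add_mem hm h2w), hu₀]

/-- **Principal logarithm of an egg point, `y < 0`**: as `exists_eggLog_of_roots_pos` with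
`s ∈ (−Ω₁/2, 0)` (apply it to `(x, −y)` and use `φ(−u) = (℘(u), −℘′(u)/2)`, `2w_I ∈ Λ`).
[cite: Lawden1989, §§6.11, 6.15; CremonaAlgorithms1997, §3.4] -/
theorem exists_eggLog_of_roots_neg (h : L.IsReal) {r₁ r₂ r₃ : ℝ} (h12 : r₂ < r₁) (h23 : r₃ < r₂)
    (hf : ∀ x, 4 * x ^ 3 - L.g₂.re * x - L.g₃.re = 4 * (x - r₁) * (x - r₂) * (x - r₃)) {x y : ℝ}
    (hc : 4 * x ^ 3 - L.g₂.re * x - L.g₃.re = 4 * y ^ 2) (h3 : r₃ < x) (h2 : x < r₂) (hy : y < 0) :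
    ∃ s : ℝ, -(L.minRealPeriod / 2) < s ∧ s < 0 ∧ phi L (wI + (s : ℂ)) = ![(x : ℂ), (y : ℂ)] := by
  obtain ⟨s, hs0, hsΩ, hs⟩ := exists_eggLog_of_roots_pos h h12 h23 hf (y := -y) (by rw [hc]; ring)
    h3 h2 (by linarith)
  obtain ⟨h2w, -, -⟩ := h.two_mul_halfPeriodI_mem
  refine ⟨-s, by linarith, by linarith, ?_⟩
  have hn := phi_neg_of_phi hs (y' := (y : ℂ)) (by push_cast; ring)
  have e : wI + ((-s : ℝ) : ℂ) = -(wI + (s : ℂ)) + 2 * wI := by push_cast; ring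
  rw [e, phi_add_of_mem L _ h2w, hn]

end Summit.KontsevichZagierPeriods.KzOnePeriods.E1RealLogs

end
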